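import Literature.AlgebraicGeometry.AbelianSchemes.AbelianSchemeRingActionLie
import Mathlib.AlgebraicGeometry.Morphisms.Affine
import Mathlib.RingTheory.Localization.Free
import Mathlib.RingTheory.Localization.FractionRing
import HarnessLib

/-!
# An affine chart of an abelian scheme around its unit section, after inverting one element of the base
# (Shimura 1998 §12.4 Prop. 26, proof p. 109; Mumford–Fogarty–Kirwan Ch. 6 §1; EGA IV₃ 8.10.5)

Topic `Literature/AlgebraicGeometry/AbelianSchemes`; namespace `Literature.AlgebraicGeometry.AbelianSchemes.AbelianScheme`.
Cell `hodgecm-mathlib` (D-0151), row II-2β (`shimura1998_prop26_definedOverQbar` `_holds` programme), A-p14's cut S1-F2c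
(04:21:17Z) in the shape of A-p03's `Motives/AbelianVarietyCotangentOfFibre` (G3b, 04:08:14Z): `(f, e, he, W, hW, heW)` plus the
`[Module.Free] [Module.Finite]` source.  SEQUEL of `AbelianSchemeAffineBase` (`AbelianScheme R`, `baseChange`),
`AbelianSchemeFibreEndomorphisms` (`fibre`, `fibreEnd`, §4 fibre square) and `AbelianSchemeRingActionLie` (`RingAction`).
CM-free; ONE definition with body (`RingAction.baseChange`, a structure instance of the tree's `RingAction`) + theorems; no named
fact, no `instance`, no `sorry` (net debt 0).  HC_CM is proved only modulo the 7 printed citations until rung 0 closes.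

THE PRINT.  [Shimura1998] §12.4 Prop. 26, proof p. 109: «(A, ι) is defined over a finitely generated extension […]; take a
specialization»; to differentiate `ι′(a)` at the origin of the specialised variety one works on an affine neighbourhood of the unit
section of a model `𝒜 → Spec R` — available after replacing `R` by `R[1/s]` ([EGA IV₃, 8.10.5]: properties spread out over a dense
open of an integral base; [MumfordFogartyKirwan1994] Ch. 6 §1: abelian schemes, unit section).  The conormal module of the unit
section is finitely presented, hence free over `R[1/r]` for some `r ≠ 0` (generic freeness at the generic point, [EGA IV₃, 8.9.4 / 6.9.2]).

WHAT IS HERE (`𝒜 : AbelianScheme R`, `f : R →+* R'`, `F_f := Over.pullback (Spec f)`, `p_f := pullback.fst 𝒜.X.hom (Spec f) : 𝒜_{R'} → 𝒜`,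
`e := η[𝒜.X].left : Spec R → 𝒜` the unit section, `e_f := η[(𝒜.baseChange f).X].left`).
* §1 the unit section under base change: `unit_left_comp_hom` (`e ≫ (𝒜 → Spec R) = 𝟙`), **`unit_baseChange_left_comp_fst`**
  (`e_f ≫ p_f = Spec f ≫ e` — the unit of the transported group object is `ε ≫ F_f.map η`, Mathlib `Functor.obj.η_def`, and
  `ε.left ≫ pullback.snd (𝟙) (Spec f) = 𝟙`, Mathlib `Functor.Monoidal.ε_η` + `Over.η_pullback_left`; ring version of
  `AbelianSchemeFibreEndomorphisms.unitPt_fibre_comp_fst`).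
* §2 the UNIFORM CHART: for an open `W₀ ⊆ 𝒜` and `s : R` with `D(s) ⊆ e⁻¹ W₀`, and ANY `f : R → R'` with `f s` a unit, the open
  `W_f := p_f⁻¹ W₀ ⊆ 𝒜_{R'}` is affine when `W₀` is (`isAffineOpen_fst_preimage`: `p_f` is an affine morphism, base change of
  `Spec R' → Spec R`) and contains the unit section, `e_f⁻¹ W_f = ⊤` (`unit_preimage_fst_preimage_eq_top`).  So ONE `s` serves every
  further localisation `R[1/s] → R[1/(s r)] → …` and every point `R[1/s] → κ`.
* §3 EXISTENCE at the generic point (`R` a domain): `exists_basicOpen_le_unit_preimage` — some affine open `W₀ ∋ e(ξ)`, `ξ = (0)` the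
  generic point, and `s ≠ 0` with `D(s) ⊆ e⁻¹ W₀`; packaged with §2 as **`exists_unitSection_chart`**: `∃ s ≠ 0, ∃ W₀` affine,
  `∀ R' f, IsUnit (f s) → IsAffineOpen W_f ∧ e_f⁻¹ W_f = ⊤` — G3b's `(W, hW, heW)` for `X := (𝒜.baseChange f).left`,
  `f := (𝒜.baseChange f).hom`, `e := e_f`, `he := unit_left_comp_hom`.
* §4 GENERIC FREENESS at the generic point (pure algebra, the `[Module.Free] [Module.Finite]` source of G3b): over a domain, a finitely
  presented module `M` becomes free and finite over `R[1/r]` for some `r ≠ 0` (`exists_ne_zero_free_localizedModule_away`; Mathlib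
  `Module.FinitePresentation.exists_free_localizedModule_powers` at `S = R⁰`, `M ⊗ Frac R` being free over the field `Frac R`).
* §5 TRANSPORT of a presented ring action along base change: `RingAction.baseChange` (`ιR a ↦ F_f.map (ιR a)`; the four identities by
  `Functor.map_id / map_comp / map_mul`), `RingAction.baseChange_ιR`.
NOT HERE: the identification `(augIdeal ε_{W_f}).Cotangent ≃ R' ⊗ (augIdeal ε_{W_s}).Cotangent` (A-p03's G3b pushout step with the
field replaced by an `R[1/s]`-algebra), the fibre transitivity `(𝒜.baseChange f).fibre φ' ≅ 𝒜.fibre (φ' ∘ f)` (sequel file), the spread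
itself (A-p14 S1-F2a/b), the type junction (S1-F4).

## References
* [Shimura1998] G. Shimura, *Abelian Varieties with Complex Multiplication and Modular Functions* (1998), §12.4 Prop. 26 (proof p. 109).
* [MumfordFogartyKirwan1994] D. Mumford, J. Fogarty, F. Kirwan, *Geometric Invariant Theory*, 3rd ed. (1994), Ch. 6 §1 Def. 6.1 (p. 115).
* [EGAIV3] A. Grothendieck, *Éléments de géométrie algébrique* IV₃, Publ. Math. IHÉS 28 (1966), 8.9.4, 8.10.5.
* [GortzWedhorn2020] U. Görtz, T. Wedhorn, *Algebraic Geometry I* (2020), Section (4.7), Prop. 12.3, Remark 16.54.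
-/

set_option autoImplicit false

universe u v w

open CategoryTheory CategoryTheory.Limits AlgebraicGeometry MonoidalCategory

noncomputable section

namespace Literature.AlgebraicGeometry.AbelianSchemes

open Literature.AlgebraicGeometry.Motives (SchemeOver AbelianVariety)
open scoped MonObj Obj

namespace AbelianScheme

variable {R : Type u} [CommRing R] (𝒜 : AbelianScheme R) {R' : Type u} [CommRing R'] (f : R →+* R')

/-! ## §1 The unit section under base change -/

/-- The unit section is a section of the structure map: `e ≫ (𝒜 → Spec R) = 𝟙`. [cite: MumfordFogartyKirwan1994, Ch. 6 §1 Def. 6.1 (p. 115)] -/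
theorem unit_left_comp_hom : η[𝒜.X].left ≫ 𝒜.X.hom = 𝟙 _ := Over.w η[𝒜.X]

/-- **The unit section of `𝒜_{R'}` lies over the unit section of `𝒜`**: `e_f ≫ p_f = Spec f ≫ e` with `p_f := pullback.fst` the
projection `𝒜_{R'} = 𝒜 ×_{Spec R} Spec R' → 𝒜`.  (The unit of the transported group object is `ε ≫ (Over.pullback (Spec f)).map η`,
Mathlib `Functor.obj.η_def`; `(F.map η).left` is a `pullback.lift`, and `ε.left ≫ pullback.snd (𝟙 (Spec R)) (Spec f) = 𝟙` from
`Functor.Monoidal.ε_η` and `Over.η_pullback_left`.) [cite: GortzWedhorn2020, Remark 16.54] -/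
theorem unit_baseChange_left_comp_fst :
    η[(𝒜.baseChange f).X].left ≫ pullback.fst 𝒜.X.hom (specMap f) = specMap f ≫ η[𝒜.X].left := by
  have h1 : ((Over.pullback (specMap f)).map η[𝒜.X]).left ≫ pullback.fst 𝒜.X.hom (specMap f) =
      pullback.fst (𝟙 (Spec (.of R))) (specMap f) ≫ η[𝒜.X].left :=
    pullback.lift_fst _ _ _
  have h2 : pullback.fst (𝟙 (Spec (.of R))) (specMap f) = pullback.snd (𝟙 (Spec (.of R))) (specMap f) ≫ specMap f := by
    simpa using pullback.condition (f := 𝟙 (Spec (.of R))) (g := specMap f)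
  have hεη : (Functor.LaxMonoidal.ε (Over.pullback (specMap f))).left ≫ pullback.snd (𝟙 (Spec (.of R))) (specMap f) =
      𝟙 _ :=
    congrArg Over.Hom.left (Functor.Monoidal.ε_η (Over.pullback (specMap f)))
  have h3 : (Functor.LaxMonoidal.ε (Over.pullback (specMap f))).left ≫ pullback.fst (𝟙 (Spec (.of R))) (specMap f) =
      specMap f :=
    (congrArg (fun t => (Functor.LaxMonoidal.ε (Over.pullback (specMap f))).left ≫ t) h2).trans <|
      (Category.assoc _ _ _).symm.trans <| (congrArg (fun t => t ≫ specMap f) hεη).trans (Category.id_comp _)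
  have h0 : η[(𝒜.baseChange f).X].left ≫ pullback.fst 𝒜.X.hom (specMap f) =
      (Functor.LaxMonoidal.ε (Over.pullback (specMap f))).left ≫
        (((Over.pullback (specMap f)).map η[𝒜.X]).left ≫ pullback.fst 𝒜.X.hom (specMap f)) :=
    Category.assoc _ _ _
  exact h0.trans <| (congrArg (fun t => (Functor.LaxMonoidal.ε (Over.pullback (specMap f))).left ≫ t) h1).trans <|
    (Category.assoc _ _ _).symm.trans <| congrArg (fun t => t ≫ η[𝒜.X].left) h3

/-! ## §2 The uniform chart `W_f := p_f⁻¹ W₀` -/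

/-- The projection `p_f : 𝒜_{R'} → 𝒜` is an affine morphism (base change of `Spec R' → Spec R`), so `p_f⁻¹ W₀` is affine when `W₀`
is. [cite: GortzWedhorn2020, Prop. 12.3] -/
theorem isAffineOpen_fst_preimage {W₀ : 𝒜.X.left.Opens} (hW₀ : IsAffineOpen W₀) :
    IsAffineOpen (pullback.fst 𝒜.X.hom (specMap f) ⁻¹ᵁ W₀) :=
  haveI : IsAffineHom (pullback.fst 𝒜.X.hom (specMap f)) :=
    MorphismProperty.pullback_fst _ _ (inferInstance : IsAffineHom (specMap f))
  hW₀.preimage _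

/-- **The chart contains the unit section**: if the basic open `D(s) ⊆ Spec R` lies in `e⁻¹ W₀` and `f s` is a unit in `R'`, then
`e_f⁻¹ (p_f⁻¹ W₀) = ⊤` — indeed `e_f⁻¹ p_f⁻¹ W₀ = (Spec f)⁻¹ (e⁻¹ W₀) ⊇ (Spec f)⁻¹ D(s) = D(f s) = Spec R'`.
[cite: EGAIV3, 8.10.5] [cite: GortzWedhorn2020, Section (4.7)] -/
theorem unit_preimage_fst_preimage_eq_top {s : R} {W₀ : 𝒜.X.left.Opens}
    (hs : PrimeSpectrum.basicOpen s ≤ η[𝒜.X].left ⁻¹ᵁ W₀) (hfs : IsUnit (f s)) :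
    η[(𝒜.baseChange f).X].left ⁻¹ᵁ (pullback.fst 𝒜.X.hom (specMap f) ⁻¹ᵁ W₀) = ⊤ := by
  rw [← Scheme.Hom.comp_preimage, unit_baseChange_left_comp_fst]
  -- `x ∈ (Spec f ≫ e)⁻¹ W₀` iff `(Spec f) x ∈ e⁻¹ W₀`, which holds as `(Spec f) x ∈ D(s)` (`f s` is a unit, so `f s ∉ x`)
  refine top_le_iff.mp fun x _ => ?_
  have hx : x ∈ Spec.map (CommRingCat.ofHom f) ⁻¹ᵁ PrimeSpectrum.basicOpen s := by
    rw [SpecMap_preimage_basicOpen]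
    exact (PrimeSpectrum.mem_basicOpen _ _).mpr fun h =>
      x.2.ne_top (Ideal.eq_top_of_isUnit_mem _ h (by simpa using hfs))
  exact hs hx

/-! ## §3 Existence of the chart datum at the generic point -/

/-- Over a DOMAIN `R`, the unit section has an affine neighbourhood over a dense open of the base: there are an affine open `W₀ ⊆ 𝒜`
(any affine neighbourhood of `e(ξ)`, `ξ = (0)` the generic point of `Spec R`) and `s ≠ 0` with `D(s) ⊆ e⁻¹ W₀` (basic opens form
a basis, and a basic open `D(s) ∋ ξ` has `s ∉ (0)`). [cite: EGAIV3, 8.10.5] [cite: Shimura1998, §12.4 Prop. 26 (proof, p. 109)] -/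
theorem exists_basicOpen_le_unit_preimage [IsDomain R] :
    ∃ s : R, s ≠ 0 ∧ ∃ W₀ : 𝒜.X.left.Opens, IsAffineOpen W₀ ∧ PrimeSpectrum.basicOpen s ≤ η[𝒜.X].left ⁻¹ᵁ W₀ := by
  -- the generic point `ξ = (0)` of `Spec R` and an affine open `W₀ ∋ e(ξ)`
  let ξ : PrimeSpectrum R := ⟨⊥, Ideal.isPrime_bot⟩
  obtain ⟨_, ⟨W₀, hW₀, rfl⟩, hξW, -⟩ :=
    𝒜.X.left.isBasis_affineOpens.exists_subset_of_mem_open (Set.mem_univ (η[𝒜.X].left.base ξ)) isOpen_univ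
  -- a basic open `D(s) ∋ ξ` inside the open `e⁻¹ W₀`; `ξ ∈ D(s)` says `s ∉ (0)`
  obtain ⟨_, ⟨s, rfl⟩, hξs : ξ ∈ PrimeSpectrum.basicOpen s, hsW : PrimeSpectrum.basicOpen s ≤ _⟩ :=
    PrimeSpectrum.isTopologicalBasis_basic_opens.exists_subset_of_mem_open
      (show ξ ∈ η[𝒜.X].left ⁻¹ᵁ W₀ from hξW) (η[𝒜.X].left ⁻¹ᵁ W₀).2
  exact ⟨s, fun h0 => (PrimeSpectrum.mem_basicOpen _ _).mp hξs (Ideal.mem_bot.mpr h0), W₀, hW₀, hsW⟩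

/-- **The unit-section chart after inverting one element** (G3b's `(W, hW, heW)` uniformly in the localisation): over a domain `R`
there are `s ≠ 0` and an affine open `W₀ ⊆ 𝒜` such that for EVERY `f : R → R'` with `f s` a unit — `R' = R[1/s]`, `R[1/(s r)]`,
a field point of `Spec R[1/s]`, … — the open `W_f := p_f⁻¹ W₀` of `𝒜_{R'} = (𝒜.baseChange f).left` is affine and contains the unit
section: `e_f⁻¹ W_f = ⊤`.  Take `X := (𝒜.baseChange f).left`, `X → Spec R'` its structure map, `e := η[(𝒜.baseChange f).X].left`
(`he`: `unit_left_comp_hom`). [cite: EGAIV3, 8.10.5] [cite: Shimura1998, §12.4 Prop. 26 (proof, p. 109)]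
[cite: MumfordFogartyKirwan1994, Ch. 6 §1 Def. 6.1 (p. 115)] -/
theorem exists_unitSection_chart [IsDomain R] :
    ∃ s : R, s ≠ 0 ∧ ∃ W₀ : 𝒜.X.left.Opens, IsAffineOpen W₀ ∧ PrimeSpectrum.basicOpen s ≤ η[𝒜.X].left ⁻¹ᵁ W₀ ∧
      ∀ (R' : Type u) [CommRing R'] (f : R →+* R'), IsUnit (f s) →
        IsAffineOpen (pullback.fst 𝒜.X.hom (specMap f) ⁻¹ᵁ W₀) ∧
          η[(𝒜.baseChange f).X].left ⁻¹ᵁ (pullback.fst 𝒜.X.hom (specMap f) ⁻¹ᵁ W₀) = ⊤ := by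
  obtain ⟨s, hs0, W₀, hW₀, hsW⟩ := 𝒜.exists_basicOpen_le_unit_preimage
  exact ⟨s, hs0, W₀, hW₀, hsW, fun R' _ f hfs =>
    ⟨𝒜.isAffineOpen_fst_preimage f hW₀, 𝒜.unit_preimage_fst_preimage_eq_top f hsW hfs⟩⟩

end AbelianScheme

/-! ## §4 Generic freeness at the generic point (pure commutative algebra) -/

/-- **Generic freeness at the generic point.**  Over a domain `R`, a finitely presented `R`-module `M` becomes FREE (and finite)
over `R[1/r]` for some `r ≠ 0`: `M ⊗ Frac R` is free over the field `Frac R = R_{(0)}`, and freeness of a finitely presented module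
at a localisation `R_S` descends to `R[1/r]` for some `r ∈ S` (Mathlib `Module.FinitePresentation.exists_free_localizedModule_powers`,
`S = R⁰`).  The `[Module.Free] [Module.Finite]` hypotheses of `Motives/AbelianVarietyCotangentOfFibre` for the conormal module of the
unit section come from here. [cite: EGAIV3, 8.9.4] -/
theorem exists_ne_zero_free_localizedModule_away {R : Type u} [CommRing R] [IsDomain R]
    (M : Type v) [AddCommGroup M] [Module R M] [Module.FinitePresentation R M] :
    ∃ r : R, r ≠ 0 ∧ Module.Free (Localization.Away r) (LocalizedModule.Away r M) ∧
      Module.Finite (Localization.Away r) (LocalizedModule.Away r M) := by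
  obtain ⟨r, hr, hfree, -⟩ := Module.FinitePresentation.exists_free_localizedModule_powers (nonZeroDivisors R)
    (LocalizedModule.mkLinearMap (nonZeroDivisors R) M) (FractionRing R)
  exact ⟨r, nonZeroDivisors.ne_zero hr, hfree,
    Module.Finite.of_isLocalizedModule (.powers r) (LocalizedModule.mkLinearMap (.powers r) M)⟩

namespace AbelianScheme

/-! ## §5 Transport of a presented ring action along base change -/

variable {R : Type u} [CommRing R] {𝒜 : AbelianScheme R} {R' : Type u} [CommRing R'] {O : Type v} [CommRing O]

/-- **Base change of a presented ring action**: `a ↦ (Over.pullback (Spec f)).map (ιR a)` is again a presented action of `O` on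
`𝒜_{R'}` by group-scheme endomorphisms — the base-change functor is monoidal, so it preserves homomorphisms (`Functor.map.instIsMonHom`),
identities and composition, and pointwise products (`Functor.map_mul`).  (Shimura's `ι` carried to a localised stage of the model.)
[cite: Shimura1998, §12.4 Prop. 26 (proof, p. 109)] [cite: GortzWedhorn2020, Remark 16.54] -/
def RingAction.baseChange (act : RingAction O 𝒜) (f : R →+* R') : RingAction O (𝒜.baseChange f) where
  ιR a := (Over.pullback (specMap f)).map (act.ιR a)
  isMonHom a := by
    haveI := act.isMonHom a
    exact Functor.map.instIsMonHom _ _ (act.ιR a)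
  map_one := by
    change (Over.pullback (specMap f)).map (act.ιR 1) = 𝟙 ((Over.pullback (specMap f)).obj 𝒜.X)
    rw [act.map_one]
    exact (Over.pullback (specMap f)).map_id _
  map_mul a b := by
    change (Over.pullback (specMap f)).map (act.ιR (a * b)) =
      (Over.pullback (specMap f)).map (act.ιR a) ≫ (Over.pullback (specMap f)).map (act.ιR b)
    rw [act.map_mul, Functor.map_comp]
  map_add a b := by
    change (Over.pullback (specMap f)).map (act.ιR (a + b)) =
      (Over.pullback (specMap f)).map (act.ιR a) * (Over.pullback (specMap f)).map (act.ιR b)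
    rw [act.map_add]
    exact Functor.map_mul (Over.pullback (specMap f)) (act.ιR a) (act.ιR b)

/-- The endomorphisms of the base-changed action are the base changes `(Over.pullback (Spec f)).map (ιR a)` (by definition).
[cite: GortzWedhorn2020, Section (4.7)] -/
@[simp]
theorem RingAction.baseChange_ιR (act : RingAction O 𝒜) (f : R →+* R') (a : O) :
    (act.baseChange f).ιR a = (Over.pullback (specMap f)).map (act.ιR a) := rfl

/-- On underlying schemes the base-changed endomorphism commutes with the projection: `(ιR a)_{R'} ≫ p_f = p_f ≫ ιR a`.
[cite: GortzWedhorn2020, Section (4.7)] -/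
theorem RingAction.baseChange_ιR_left_comp_fst (act : RingAction O 𝒜) (f : R →+* R') (a : O) :
    ((act.baseChange f).ιR a).left ≫ pullback.fst 𝒜.X.hom (specMap f) = pullback.fst 𝒜.X.hom (specMap f) ≫ (act.ιR a).left :=
  pullback.lift_fst _ _ _

end AbelianScheme

end Literature.AlgebraicGeometry.AbelianSchemes

end
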